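import Literature.MathematicalPhysics.QuantumFieldTheory.Balaban1983to89.B7Eq99ConcreteRec
import Literature.MathematicalPhysics.QuantumFieldTheory.Balaban1983to89.B7Eq84Concrete

/-!
# `Balaban1983to89.B7Eq84ConcreteRec` — [Balaban1985Averaging] Sect. D (72)–(77), (79)–(81), (84), (86)–(88) pp. 29–31 FOR THE RECORD's AVERAGING STRUCTURE ([Balaban1987RG1] (0.3)–(0.4)):
# the block axial gauge fixing — (84) under (67), (81) ⇔ (87), (88), EXISTENCE AND UNIQUENESS of the gauge fixing `glevZ`, and the telescoped contour formula (77) — for the record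
# twins `uavgZ ∕ AxialGaugeZ ∕ glevZ ∕ telHolZ ∕ telTwZ`; exact identities, proofs re-run from the engine's `B7Eq84Concrete`

statement-level skeleton of published theorems with citation tags; proofs where landed; nothing here is a claim about the Yang–Mills mass gap

CITATION HEADER (lean-in-tree rule).  Cell `pub-ymgap`, seat `pub-ymgap-dag-n05-e` g35 (N05-REC LEAD PEN); item R1 ([3] layer) of the road — the Sect. D GAUGE-FIXING IDENTITIES that the cell's R2
(`B8Eq115GaugeFixingRec`, n05-d: (1.15)–(1.17) of [Balaban1987RG1]) and R4 (`B8Eq131DerivationRec`) wait for.  `--kind proof --supports stmt-QuantumFields-20541` (K0⁷; count-neutral; no definition).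
Sources READ: [3] pp. 29–31 (`paper:balaban1985-cmp98-averaging`) through the engine module `B7Eq84Concrete`, whose §2–§5 proofs are re-run token for token over the record objects (TOKEN RULE:
`bavg ↦ bavgZ`, `avgIter ↦ avgIterZ`, block points `y + boxVec L r ↦ y + offZ L r`, block decomposition `fl ∕ brem ∕ bzero ↦ flZ ∕ bremZ ∕ bctrZ` (blocks CENTRED at `L·z`, [Balaban1987RG1] (0.3)),
the Sect. C–D objects ↦ their `…Z` twins of `B7SectCDGaugeAveragesRec`; (99) from `B7Eq99ConcreteRec.wrecZ_eq_vcovZ`, (92)∕(97) from `B7Eq92ConcreteRec`).  The solved gauge conditions over a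
group (§1 of the engine: `R0fun_mul`, `eq72_iff_eq76`), `Rc_injective` and the group algebra are REUSED BY NAME.  The flat-background reductions are NOT twinned here (LOCATED-N2 layer).
WHAT IS PROVED (sorry-free): §2 `SexpZ_congr`, `savgZ_congr`, `uavgZ_one`; §3 `AxialGaugeZ.mono`, `eq76_of_axialGaugeZ`, ★`eq84Z` ((84) under (67)), `eq84Z_top`, ★`eq81_iff_eq87Z`, ★`eq88Z`, `avgIterZ_eq_of_gauge`;
§4 `bremZ_centre`, `glevZ_of_lt`, `glevZ_top`, `glevZ_centre`, `uLev_glevZ`, `glevZ_block`, ★`axialGaugeZ_glevZ` + ★`eq81_glevZ` (EXISTENCE: `u := glevZ … k 0` satisfies (67) and (81)), `gaugeFixingZ_exists`,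
★★`gaugeFixingZ_unique` (UNIQUENESS), `eq88_glevZ`, `avgIterZ_glevZ`; §5 `telHolZ_succ`, `telTwZ_succ`, `telRotZ_succ`, ★`eq77Z` ((77) at every level), `gauge_formulaZ`, `glevZ_formula`.
HONEST SCOPE.  Exact algebraic identities for OUR typed record objects; no estimate; `HThm4Rec` UNDISCHARGED; N05 ∕ N07 NOT discharged; counts unmoved (typed 28∕28 · discharged 7∕28);
one finite 𝕋⁴ programme at fixed ε — nothing continuum ∕ ℝ⁴ ∕ OS ∕ mass gap ∕ Clay.  No `def`, no `instance`, no `notation`, no `sorry`.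
-/

set_option autoImplicit false

noncomputable section

open scoped BigOperators
open NormedSpace Finset

namespace Literature.MathematicalPhysics.QuantumFieldTheory.Balaban1983to89.B7Eq84ConcreteRec

open B7Prop1Explicit hiding Site
open B7Prop1Explicit renaming Site → SiteZ
open B7Prop2Explicit (rescale rescale_apply)
open MatrixLog B7AvgGaugeCovariance
open B7Eq92Concrete (Rc Rc_apply Rc_mul Rc_inv_apply Rc_one_apply mgauge mgauge_apply mgauge_mul tHol tHol_nil tHol_append_true tHol_append_false tHol_mgauge mlog_Rc expUnit_conj
  frame_eq_mgauge)
open B7Eq99Concrete (R0fun R0fun_apply R0fun_self R0fun_one_left R0fun_add inv_mul_const_mul tHol_mgauge_mul_R0fun)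
open B7Eq84Concrete (R0fun_mul eq72_iff_eq76 Rc_injective)
open BlockAveragingZd (offZ bavgZ avgIterZ avgIterZ_zero avgIterZ_succ)
open BlockAveragingZdCovariance (bavgZ_gaugeAct_units avgIterZ_gaugeAct_units)
open B7SectCDGaugeAveragesRec (flZ bremZ bctrZ offZ_bctrZ flZ_decomp flZ_block bremZ_block FcovZ wframeZ tildZ dbavgCovZ tildIterZ dbavgCovIterZ vcovZ SexpZ savgZ R0avgZ
  wrecZ wrecZ_zero tildIterZ_apply uavgZ uavgZ_zero uavgZ_succ AxialGaugeZ glevZ telHolZ telTwZ telHolZ_zero telTwZ_zero)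
open B7Eq92ConcreteRec (tildZ_apply dbavgCovZ_apply tildIter_zero')
open B7Eq99ConcreteRec (SexpZ_apply savgZ_apply val_savgZ savgZ_const_mul savgZ_of_center_eq_one savgZ_tHol val_R0avgZ R0avgZ_of_60 wrecZ_succ wrecZ_one wrecZ_eq_vcovZ
  step100Z eq92Z tildIterZ_eq_mgauge_wrecZ eq88_of_87Z avgIterZ_eq_of_87)

variable {d : ℕ}

/-! ## §2–§4 Block-point congruence of (78), the averaging (79)∕(80), (84) under (67), (81) ⇔ (87), (88), and the gauge fixing `glevZ` for the record blocks -/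

section Averaging

variable {𝔸 : Type*} [NormedRing 𝔸] [NormedAlgebra ℂ 𝔸] [CompleteSpace 𝔸]

omit [CompleteSpace 𝔸] in
/-- The exponent (78) depends on `g` only through its values at the centre `y` and at the block points `y + r`,
`r ∈ [0, L)^d`. [cite: Balaban1985Averaging, (78) p.30] -/
theorem SexpZ_congr (L : ℕ) {g g' : SiteZ d → 𝔸ˣ} {y : SiteZ d} (h0 : g y = g' y)
    (h : ∀ r : Fin d → Fin L, g (y + offZ L r) = g' (y + offZ L r)) : SexpZ L g y = SexpZ L g' y := by
  simp only [SexpZ_apply, h0, h]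

/-- The site average (78) `{g(x)}_{x∈B(y)}` depends on `g` only through `g(y)` and the block values `g(y + r)`.
[cite: Balaban1985Averaging, (78) p.30] -/
theorem savgZ_congr (L : ℕ) {g g' : SiteZ d → 𝔸ˣ} {y : SiteZ d} (h0 : g y = g' y)
    (h : ∀ r : Fin d → Fin L, g (y + offZ L r) = g' (y + offZ L r)) : savgZ L g y = savgZ L g' y := by
  rw [savgZ_apply, savgZ_apply, SexpZ_congr L h0 h, h0]

/-- `uavgZ_one` = (79): `(R̄₀u)(x₁) = (\overline{R(U₀)u})(x₁)`, the twisted site average (78) at `U₀` read on `Ω^{(1)}`.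
[cite: Balaban1985Averaging, (79) p.30] -/
theorem uavgZ_one (L : ℕ) (U₀ : SiteZ d → Fin d → 𝔸ˣ) (u : SiteZ d → 𝔸ˣ) (z : SiteZ d) :
    uavgZ L U₀ u 1 z = R0avgZ L U₀ u ((L : ℤ) • z) := by
  rw [uavgZ_succ, avgIterZ_zero]
  rfl

/-! ## §3 (84) under the block axial gauge (67), (81) ⇔ (87), and (88) under (67) + (81) -/

/-- `AxialGaugeZ` is monotone in the number of levels. [cite: Balaban1985Averaging, (67) p.29] -/
theorem AxialGaugeZ.mono {L : ℕ} {U₀ U₁ : SiteZ d → Fin d → 𝔸ˣ} {u : SiteZ d → 𝔸ˣ} {k k' : ℕ} (h : AxialGaugeZ L U₀ U₁ u k)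
    (hk : k' ≤ k) : AxialGaugeZ L U₀ U₁ u k' :=
  fun j hj z r => h j (lt_of_lt_of_le hj hk) z r

/-- **(67) ⇒ (76)** at the block points: under the axial gauge at level `j`, the rotated gauge function read at level `j`
satisfies "(R̄^j_{0,x_{j+1}}u)(x_j) = u(x_{j+1})(R̄^j_{0,x_{j+1}}Ũ^j_1)(Γ_{x_{j+1},x_j}) for x_j ∈ B(x_{j+1}), x_{j+1} ∈ Ω^{(j+1)}. (76)"
(`u` at level `j` is `uLev L u j`, by (70)/(71) `B7Eq92Concrete.B7Eq92ConcreteRec.tildIterZ_mgauge`). [cite: Balaban1985Averaging, (76) p.29, (71) p.29] -/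
theorem eq76_of_axialGaugeZ (L : ℕ) (U₀ U₁ : SiteZ d → Fin d → 𝔸ˣ) (u : SiteZ d → 𝔸ˣ) {k j : ℕ}
    (hax : AxialGaugeZ L U₀ U₁ u k) (hj : j < k) (z : SiteZ d) (r : Fin d → Fin L) :
    R0fun (avgIterZ L U₀ j) ((L : ℤ) • z) (uLev L u j) ((L : ℤ) • z + offZ L r)
      = uLev L u j ((L : ℤ) • z)
        * tHol (avgIterZ L U₀ j) (tildIterZ L U₀ U₁ j) ((L : ℤ) • z) (treeWord (offZ L r)) := by
  have h := hax j hj z r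
  rw [B7Eq92ConcreteRec.tildIterZ_mgauge] at h
  have h' := (eq72_iff_eq76 (avgIterZ L U₀ j) (tildIterZ L U₀ U₁ j) (uLev L u j) ((L : ℤ) • z)
    ((L : ℤ) • z + offZ L r)).1
  rw [add_sub_cancel_left] at h'
  exact h' h

/-- **(84)** p. 30: "We easily find by induction that (\overline{R₀u}^j)(x_j) = u(x_j)\overline{R_{0,x_j}U₁}^{(j)}, x_j ∈ Ω^{(j)}, (84)"
— under the block axial gauge (67) at the levels `j < k`, the `j`-th order average (79)/(80) of the gauge function is the
gauge function read at level `j` times the block average (85) `\overline{R_{0,·}U₁^{(j)}}` (`B7Eq99Concrete.wrec`), for all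
`j ≤ k` ((82), (83) are the cases `j = 1, 2`). Inputs, as printed: (76) (from (67)), the multiplicativity of `R` (57) and the
left-invariance of the site average (78). [cite: Balaban1985Averaging, (84) p.30, (82)–(83) p.30, (85) p.31] -/
theorem eq84Z (L : ℕ) (U₀ U₁ : SiteZ d → Fin d → 𝔸ˣ) (u : SiteZ d → 𝔸ˣ) {k : ℕ} (hax : AxialGaugeZ L U₀ U₁ u k) :
    ∀ j ≤ k, uavgZ L U₀ u j = fun z => uLev L u j z * wrecZ L U₀ U₁ j z
  | 0, _ => by
    funext z
    simp
  | j + 1, hj => by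
    have hjk : j < k := Nat.lt_of_succ_le hj
    funext z
    rw [uavgZ_succ, eq84Z L U₀ U₁ u hax j hjk.le, R0avgZ, wrecZ_succ, ← uLev_smul L u j z, ← savgZ_const_mul]
    apply savgZ_congr
    · simp only [R0fun_self, sub_self, treeWord_zero, tHol_nil, one_mul]
    · intro r
      rw [R0fun_mul, eq76_of_axialGaugeZ L U₀ U₁ u hax hjk z r, add_sub_cancel_left, mul_assoc]

/-- (84) at the top level `j = k`, pointwise. [cite: Balaban1985Averaging, (84) p.30] -/
theorem eq84Z_top (L : ℕ) (U₀ U₁ : SiteZ d → Fin d → 𝔸ˣ) (u : SiteZ d → 𝔸ˣ) {k : ℕ} (hax : AxialGaugeZ L U₀ U₁ u k)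
    (z : SiteZ d) : uavgZ L U₀ u k z = uLev L u k z * wrecZ L U₀ U₁ k z := by
  rw [eq84Z L U₀ U₁ u hax k le_rfl]

/-- **(81) ⇔ (86) ⇔ (87)** p. 30–31: under the axial gauge (67), the averaging condition "(\overline{R₀u}^k)(y) = 1, y ∈ Ω^{(k)}. (81)"
is equivalent to "u(y) = (\overline{R_{0,y}U₁^{(k)}})⁻¹. (87)" (via (84): "(\overline{R₀u^k})(y) = u(y)\overline{R_{0,y}U₁^{(k)}} = 1 for
y ∈ Ω^{(k)}, (86)") —
the values of `u` on `Ω^{(k)}` are uniquely determined. [cite: Balaban1985Averaging, (81) p.30, (86)–(87) p.31] -/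
theorem eq81_iff_eq87Z (L : ℕ) (U₀ U₁ : SiteZ d → Fin d → 𝔸ˣ) (u : SiteZ d → 𝔸ˣ) {k : ℕ} (hax : AxialGaugeZ L U₀ U₁ u k)
    (z : SiteZ d) : uavgZ L U₀ u k z = 1 ↔ uLev L u k z = (wrecZ L U₀ U₁ k z)⁻¹ := by
  rw [eq84Z_top L U₀ U₁ u hax z, mul_eq_one_iff_eq_inv]

/-- **(88) UNDER THE PRINTED GAUGE CONDITIONS** p. 31: if `U′ = U₁^u` (moving frame at `U₀`) satisfies the block axial gauge
conditions (64)/(66)/(67) at the levels `j < k` and the averaging condition (81) at level `k`, then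
"Ū^k_b(Ū₀^k)_b⁻¹ = (\overline{U′U₀}^k)_b(Ū₀^k)_b⁻¹ = u(b₋)(\overline{U₁U₀}^k)_b(Ū₀^k)_b⁻¹R̄^k_{0,b}u⁻¹(b₊) = (\overline{R_{0,b₋}U₁^{(k)}})⁻¹Ũ₁^kR̄^k_{0,b}\overline{R_{0,b₊}U₁^{(k)}},
b ⊂ Ω^{(k)}. (88)" `= (U̿₁^k)_b` (92): the `k`-fold average of the gauge-fixed field relative to the background IS the explicit double-bar average (90)/(91)
`B7Eq92Concrete.dbavgCovIter`. (The EXISTENCE of such a `u` is §4, `gaugeFixingZ_exists`/`eq88_glevZ`; its closed form — print's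
"(77) for `j = k − 1` and (87)" — is §5, `gauge_formulaZ`.)
[cite: Balaban1985Averaging, (88) p.31, (81) p.30, (67) p.29, (92) p.31] -/
theorem eq88Z (L : ℕ) (U₀ U₁ : SiteZ d → Fin d → 𝔸ˣ) (u : SiteZ d → 𝔸ˣ) (k : ℕ) (hax : AxialGaugeZ L U₀ U₁ u k)
    (h81 : ∀ z : SiteZ d, uavgZ L U₀ u k z = 1) :
    tildIterZ L U₀ (mgauge U₀ u U₁) k = dbavgCovIterZ L U₀ U₁ k :=
  eq88_of_87Z L U₀ U₁ u k fun z => (eq81_iff_eq87Z L U₀ U₁ u hax z).1 (h81 z)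

/-- (88)/(43) for the full average under (67) + (81): `(\overline{U′U₀})^k = U̿₁^k·Ū₀^k` — in the block axial gauge with the
averaging condition, NO frame is left over in the `k`-fold average. [cite: Balaban1985Averaging, (88) p.31, (43) p.23] -/
theorem avgIterZ_eq_of_gauge (L : ℕ) (U₀ U₁ : SiteZ d → Fin d → 𝔸ˣ) (u : SiteZ d → 𝔸ˣ) (k : ℕ)
    (hax : AxialGaugeZ L U₀ U₁ u k) (h81 : ∀ z : SiteZ d, uavgZ L U₀ u k z = 1) :
    avgIterZ L (mgauge U₀ u U₁ * U₀) k = dbavgCovIterZ L U₀ U₁ k * avgIterZ L U₀ k :=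
  avgIterZ_eq_of_87 L U₀ U₁ u k fun z => (eq81_iff_eq87Z L U₀ U₁ u hax z).1 (h81 z)

/-! ## §4 Existence and uniqueness of the gauge fixing: "Thus the gauge transformation is uniquely determined by all the
conditions and is given by the formulas (77) for `j = k − 1` and by (87)." (p. 31) — over `ℤ^d`, for `L ≥ 1` -/


omit [NormedAlgebra ℂ 𝔸] [CompleteSpace 𝔸] in
/-- `bremZ (Lz)` is the centre position ([Balaban1987RG1] (0.3): blocks centred at `L·z`). [cite: Balaban1987RG1, (0.3) p.252] -/
theorem bremZ_centre {L : ℕ} (hL : 1 ≤ L) (z : SiteZ d) : bremZ L hL ((L : ℤ) • z) = bctrZ hL := by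
  have h := bremZ_block hL z (bctrZ hL)
  rwa [offZ_bctrZ, add_zero] at h

omit [NormedAlgebra ℂ 𝔸] [CompleteSpace 𝔸] in
/-- `flZ (Lz) = z`: the centre of the centred block `B(Lz)` lies in it ([Balaban1987RG1] (0.3)). [cite: Balaban1987RG1, (0.3) p.252] -/
theorem flZ_smul {L : ℕ} (hL : 1 ≤ L) (z : SiteZ d) : flZ L ((L : ℤ) • z) = z := by
  have h := flZ_block hL z (bctrZ hL)
  rwa [offZ_bctrZ, add_zero] at h

/-- `glev` below the top level: (76) as a definition. [cite: Balaban1985Averaging, (76) p.29] -/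
theorem glevZ_of_lt (L : ℕ) (hL : 1 ≤ L) (U₀ U₁ : SiteZ d → Fin d → 𝔸ˣ) {k j : ℕ} (h : j < k) (x : SiteZ d) :
    glevZ L hL U₀ U₁ k j x
      = Rc (hol (avgIterZ L U₀ j) ((L : ℤ) • flZ L x) (treeWord (offZ L (bremZ L hL x))))⁻¹
          (glevZ L hL U₀ U₁ k (j + 1) (flZ L x)
            * tHol (avgIterZ L U₀ j) (tildIterZ L U₀ U₁ j) ((L : ℤ) • flZ L x) (treeWord (offZ L (bremZ L hL x)))) := by
  rw [glevZ, dif_pos h]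

/-- `glev` at the top level `j = k`: (87) as a definition, `u_k = (\overline{R_{0,·}U₁^{(k)}})⁻¹`.
[cite: Balaban1985Averaging, (87) p.31] -/
theorem glevZ_top (L : ℕ) (hL : 1 ≤ L) (U₀ U₁ : SiteZ d → Fin d → 𝔸ˣ) (k : ℕ) (x : SiteZ d) :
    glevZ L hL U₀ U₁ k k x = (wrecZ L U₀ U₁ k x)⁻¹ := by
  rw [glevZ, dif_neg (lt_irrefl k)]

/-- Consistency across levels: at a block centre `y = Lz` the level-`j` function is the level-`(j+1)` function,
`u_j(Lz) = u_{j+1}(z)` ((76) at `x_j = x_{j+1}` is trivial: `Γ_{y,y} = ∅`). [cite: Balaban1985Averaging, (76) p.29] -/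
theorem glevZ_centre (L : ℕ) (hL : 1 ≤ L) (U₀ U₁ : SiteZ d → Fin d → 𝔸ˣ) {k j : ℕ} (h : j < k) (z : SiteZ d) :
    glevZ L hL U₀ U₁ k j ((L : ℤ) • z) = glevZ L hL U₀ U₁ k (j + 1) z := by
  rw [glevZ_of_lt L hL U₀ U₁ h, flZ_smul hL, bremZ_centre hL, offZ_bctrZ, treeWord_zero, tHol_nil, mul_one,
    hol_nil, inv_one, Rc_one_apply]

/-- The gauge transformation `u := glev … k 0` read at level `j ≤ k` IS the level-`j` function: `u_j = glev … k j`
(by the consistency `glevZ_centre`). [cite: Balaban1985Averaging, (77) p.30] -/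
theorem uLev_glevZ (L : ℕ) (hL : 1 ≤ L) (U₀ U₁ : SiteZ d → Fin d → 𝔸ˣ) (k : ℕ) :
    ∀ j ≤ k, uLev L (glevZ L hL U₀ U₁ k 0) j = glevZ L hL U₀ U₁ k j
  | 0, _ => uLev_zero _ _
  | j + 1, hj => by
    funext z
    rw [← uLev_smul, uLev_glevZ L hL U₀ U₁ k j (Nat.le_of_succ_le hj)]
    exact glevZ_centre L hL U₀ U₁ (Nat.lt_of_succ_le hj) z

/-- The level functions satisfy the solved gauge condition (76) on every block. [cite: Balaban1985Averaging, (76) p.29] -/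
theorem glevZ_block (L : ℕ) (hL : 1 ≤ L) (U₀ U₁ : SiteZ d → Fin d → 𝔸ˣ) {k j : ℕ} (h : j < k) (z : SiteZ d)
    (r : Fin d → Fin L) :
    R0fun (avgIterZ L U₀ j) ((L : ℤ) • z) (glevZ L hL U₀ U₁ k j) ((L : ℤ) • z + offZ L r)
      = glevZ L hL U₀ U₁ k (j + 1) z
        * tHol (avgIterZ L U₀ j) (tildIterZ L U₀ U₁ j) ((L : ℤ) • z) (treeWord (offZ L r)) := by
  rw [R0fun_apply, add_sub_cancel_left, glevZ_of_lt L hL U₀ U₁ h, flZ_block hL, bremZ_block hL]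
  exact (Rc_inv_apply _ _).2

/-- **Existence, gauge conditions**: `U₁^u` with `u := glev … k 0` satisfies the block axial gauge conditions (64)/(66)/(67)
at every level `j < k`. [cite: Balaban1985Averaging, (67) p.29, (76)–(77) p.29–30] -/
theorem axialGaugeZ_glevZ (L : ℕ) (hL : 1 ≤ L) (U₀ U₁ : SiteZ d → Fin d → 𝔸ˣ) (k : ℕ) :
    AxialGaugeZ L U₀ U₁ (glevZ L hL U₀ U₁ k 0) k := by
  intro j hj z r
  rw [B7Eq92ConcreteRec.tildIterZ_mgauge, uLev_glevZ L hL U₀ U₁ k j hj.le]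
  have h := (eq72_iff_eq76 (avgIterZ L U₀ j) (tildIterZ L U₀ U₁ j) (glevZ L hL U₀ U₁ k j) ((L : ℤ) • z)
    ((L : ℤ) • z + offZ L r)).2
  rw [add_sub_cancel_left] at h
  exact h (by rw [glevZ_block L hL U₀ U₁ hj z r, glevZ_centre L hL U₀ U₁ hj z])

/-- **Existence, averaging condition**: `u := glev … k 0` satisfies (81) `(\overline{R₀u}^k)(y) = 1`.
[cite: Balaban1985Averaging, (81) p.30, (87) p.31] -/
theorem eq81_glevZ (L : ℕ) (hL : 1 ≤ L) (U₀ U₁ : SiteZ d → Fin d → 𝔸ˣ) (k : ℕ) (z : SiteZ d) :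
    uavgZ L U₀ (glevZ L hL U₀ U₁ k 0) k z = 1 := by
  rw [eq81_iff_eq87Z L U₀ U₁ _ (axialGaugeZ_glevZ L hL U₀ U₁ k) z,
    congrFun (uLev_glevZ L hL U₀ U₁ k k le_rfl) z, glevZ_top]

/-- **EXISTENCE of the gauge fixing** (p. 30–31): for every background `U₀`, every configuration `U₁` (units of `𝔸`), every
`L ≥ 1` and every `k`, there is a gauge transformation `u` on `ℤ^d` such that `U′ = U₁^u` (moving frame (55) at `U₀`) satisfies
the block axial gauge conditions (64)/(66)/(67) at the levels `j < k` and the averaging condition (81) at level `k` — namely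
`u = glev … k 0` ((77) for `j = k − 1` below the values (87)). No smallness, no unitarity needed: pure algebra.
[cite: Balaban1985Averaging, (77)–(81) p.30, (87) p.31] -/
theorem gaugeFixingZ_exists (L : ℕ) (hL : 1 ≤ L) (U₀ U₁ : SiteZ d → Fin d → 𝔸ˣ) (k : ℕ) :
    ∃ u : SiteZ d → 𝔸ˣ, AxialGaugeZ L U₀ U₁ u k ∧ ∀ z : SiteZ d, uavgZ L U₀ u k z = 1 :=
  ⟨glevZ L hL U₀ U₁ k 0, axialGaugeZ_glevZ L hL U₀ U₁ k, eq81_glevZ L hL U₀ U₁ k⟩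

/-- **UNIQUENESS of the gauge fixing** (p. 31: "Thus the gauge transformation is uniquely determined by all the
conditions"): two gauge transformations satisfying the block axial gauge conditions (67) at the levels `j < k` and the
averaging condition (81) at level `k` (same `U₀`, `U₁`, `L ≥ 1`) are EQUAL on all of `ℤ^d`. Proof as printed: (87) pins `u` on
`Ω^{(k)}`, and (76) pins `u` on each block of level `j` given its value at the block centre, downward in `j`.
[cite: Balaban1985Averaging, (76)–(77) p.29–30, (86)–(87) p.31] -/
theorem gaugeFixingZ_unique (L : ℕ) (hL : 1 ≤ L) (U₀ U₁ : SiteZ d → Fin d → 𝔸ˣ) (k : ℕ) {u u' : SiteZ d → 𝔸ˣ}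
    (hax : AxialGaugeZ L U₀ U₁ u k) (h81 : ∀ z : SiteZ d, uavgZ L U₀ u k z = 1)
    (hax' : AxialGaugeZ L U₀ U₁ u' k) (h81' : ∀ z : SiteZ d, uavgZ L U₀ u' k z = 1) : u = u' := by
  have key : ∀ i ≤ k, uLev L u (k - i) = uLev L u' (k - i) := by
    intro i
    induction i with
    | zero =>
      intro _
      funext z
      rw [Nat.sub_zero, (eq81_iff_eq87Z L U₀ U₁ u hax z).1 (h81 z), (eq81_iff_eq87Z L U₀ U₁ u' hax' z).1 (h81' z)]
    | succ i ih =>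
      intro hi
      have hj : k - (i + 1) < k := by omega
      have hj1 : k - (i + 1) + 1 = k - i := by omega
      funext x
      have e := eq76_of_axialGaugeZ L U₀ U₁ u hax hj (flZ L x) (bremZ L hL x)
      have e' := eq76_of_axialGaugeZ L U₀ U₁ u' hax' hj (flZ L x) (bremZ L hL x)
      rw [flZ_decomp hL x] at e e'
      have hc : uLev L u (k - (i + 1)) ((L : ℤ) • flZ L x) = uLev L u' (k - (i + 1)) ((L : ℤ) • flZ L x) := by
        rw [uLev_smul, uLev_smul, hj1, ih (by omega)]
      rw [hc, ← e', R0fun_apply, R0fun_apply] at e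
      exact Rc_injective _ e
  have h := key k le_rfl
  rwa [Nat.sub_self, uLev_zero, uLev_zero] at h

/-- **The gauge fixing determines the average**: for THE gauge-fixed field `U′ = U₁^u`, `u = glev … k 0`, the `k`-fold average
relative to the background is the explicit double-bar average, `(\overline{U′U₀})^k(Ū₀^k)⁻¹ = U̿₁^k` (88)/(92) — unconditionally.
[cite: Balaban1985Averaging, (88) p.31, (92) p.31] -/
theorem eq88_glevZ (L : ℕ) (hL : 1 ≤ L) (U₀ U₁ : SiteZ d → Fin d → 𝔸ˣ) (k : ℕ) :
    tildIterZ L U₀ (mgauge U₀ (glevZ L hL U₀ U₁ k 0) U₁) k = dbavgCovIterZ L U₀ U₁ k :=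
  eq88Z L U₀ U₁ _ k (axialGaugeZ_glevZ L hL U₀ U₁ k) (eq81_glevZ L hL U₀ U₁ k)

/-- … and for the full average: `\overline{(U₁^u·U₀)}^k = U̿₁^k·Ū₀^k` with `u = glev … k 0`.
[cite: Balaban1985Averaging, (88) p.31, (43) p.23] -/
theorem avgIterZ_glevZ (L : ℕ) (hL : 1 ≤ L) (U₀ U₁ : SiteZ d → Fin d → 𝔸ˣ) (k : ℕ) :
    avgIterZ L (mgauge U₀ (glevZ L hL U₀ U₁ k 0) U₁ * U₀) k = dbavgCovIterZ L U₀ U₁ k * avgIterZ L U₀ k :=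
  avgIterZ_eq_of_gauge L U₀ U₁ _ k (axialGaugeZ_glevZ L hL U₀ U₁ k) (eq81_glevZ L hL U₀ U₁ k)

end Averaging

/-! ## §5 The telescoped multi-level contour formula (77) for the record blocks -/

section Telescoped

variable {𝔸 : Type*} [NormedRing 𝔸] [NormedAlgebra ℂ 𝔸] [CompleteSpace 𝔸]

/-- `U₀(Γ^{(m+1)}_{x_{m+1},x}) = Ū₀^m(Γ_{x_{m+1},x_m})·U₀(Γ^{(m)}_{x_m,x})` (top level on the left, as printed).
[cite: Balaban1985Averaging, p.29 (display before (77))] -/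
theorem telHolZ_succ (L : ℕ) (hL : 1 ≤ L) (U₀ : SiteZ d → Fin d → 𝔸ˣ) (m : ℕ) (x : SiteZ d) :
    telHolZ L hL U₀ (m + 1) x
      = hol (avgIterZ L U₀ m) ((L : ℤ) • flZ L ((flZ L)^[m] x)) (treeWord (offZ L (bremZ L hL ((flZ L)^[m] x))))
          * telHolZ L hL U₀ m x := rfl

/-- The recursion generating print's product in (77). [cite: Balaban1985Averaging, (77) p.30] -/
theorem telTwZ_succ (L : ℕ) (hL : 1 ≤ L) (U₀ U₁ : SiteZ d → Fin d → 𝔸ˣ) (m : ℕ) (x : SiteZ d) :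
    telTwZ L hL U₀ U₁ (m + 1) x
      = tHol (avgIterZ L U₀ m) (tildIterZ L U₀ U₁ m) ((L : ℤ) • flZ L ((flZ L)^[m] x))
            (treeWord (offZ L (bremZ L hL ((flZ L)^[m] x))))
          * Rc (hol (avgIterZ L U₀ m) ((L : ℤ) • flZ L ((flZ L)^[m] x)) (treeWord (offZ L (bremZ L hL ((flZ L)^[m] x)))))
              (telTwZ L hL U₀ U₁ m x) := rfl

/-- The operator identity before (77): "`(R̄^j_{0,x_{j+1}}R̄^{j−1}_{0,x_j}·…·R̄_{0,x₂}R_{0,x₁}u)(x) = R(U₀(Γ^{(j+1)}_{x_{j+1},x}))u(x)`"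
— composing one more level rotation `R(Ū₀^m(Γ_{x_{m+1},x_m}))` with the rotation by `U₀(Γ^{(m)}_{x_m,x})` is the rotation by
`U₀(Γ^{(m+1)}_{x_{m+1},x})`, by (57) `R(X)R(Y) = R(XY)`. [cite: Balaban1985Averaging, p.29 (display before (77)), (57) p.27] -/
theorem telRotZ_succ (L : ℕ) (hL : 1 ≤ L) (U₀ : SiteZ d → Fin d → 𝔸ˣ) (m : ℕ) (x : SiteZ d) (X : 𝔸ˣ) :
    Rc (telHolZ L hL U₀ (m + 1) x) X
      = Rc (hol (avgIterZ L U₀ m) ((L : ℤ) • flZ L ((flZ L)^[m] x)) (treeWord (offZ L (bremZ L hL ((flZ L)^[m] x)))))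
          (Rc (telHolZ L hL U₀ m x) X) := by
  rw [telHolZ_succ, Rc_mul, MonoidHom.comp_apply]

/-- **(77)** at every level: under the block axial gauge conditions (67) at the levels `j < k`, for every `m ≤ k` and every
site `x`, `R(U₀(Γ^{(m)}_{x_m,x}))u(x) = u(x_m)·(R_{0,x_m}U₁)(Γ^{(m)}_{x_m,x})` (`u(x_m)` = `uLev L u m x_m`, `x_m = (flZ L)^[m] x`).
Print's proof: iterate (76) — each step is (76) at level `m` for the block point `x_m ∈ B(x_{m+1})`, conjugated by the
rotation accumulated so far, using the multiplicativity of `R`. The case `m = 1` is (73), `m = 2` is (75).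
[cite: Balaban1985Averaging, (77) p.30, (73)–(76) p.29] -/
theorem eq77Z (L : ℕ) (hL : 1 ≤ L) (U₀ U₁ : SiteZ d → Fin d → 𝔸ˣ) (u : SiteZ d → 𝔸ˣ) {k : ℕ}
    (hax : AxialGaugeZ L U₀ U₁ u k) :
    ∀ m ≤ k, ∀ x : SiteZ d,
      Rc (telHolZ L hL U₀ m x) (u x) = uLev L u m ((flZ L)^[m] x) * telTwZ L hL U₀ U₁ m x := by
  intro m
  induction m with
  | zero =>
    intro _ x
    simp
  | succ m ih =>
    intro hm x
    have e := eq76_of_axialGaugeZ L U₀ U₁ u hax (show m < k by omega) (flZ L ((flZ L)^[m] x))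
      (bremZ L hL ((flZ L)^[m] x))
    rw [R0fun_add, flZ_decomp hL, uLev_smul] at e
    rw [telRotZ_succ, ih (by omega) x, map_mul, e, telTwZ_succ, Function.iterate_succ_apply', mul_assoc]

/-- **"(77) for `j = k − 1` and (87)"** (p. 31: "the gauge transformation is uniquely determined by all the conditions and is
given by the formulas (77) for `j = k − 1` and by (87)"): a gauge transformation satisfying (67) at the levels `j < k` and the
averaging condition (81) at level `k` is given in closed form by
`u(x) = R(U₀(Γ^{(k)}_{x_k,x}))⁻¹[(\overline{R_{0,x_k}U₁^{(k)}})⁻¹ · (R_{0,x_k}U₁)(Γ^{(k)}_{x_k,x})]`, `x_k = (flZ L)^[k] x`.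
[cite: Balaban1985Averaging, (77) p.30, (87) p.31] -/
theorem gauge_formulaZ (L : ℕ) (hL : 1 ≤ L) (U₀ U₁ : SiteZ d → Fin d → 𝔸ˣ) {u : SiteZ d → 𝔸ˣ} {k : ℕ}
    (hax : AxialGaugeZ L U₀ U₁ u k) (h81 : ∀ z : SiteZ d, uavgZ L U₀ u k z = 1) (x : SiteZ d) :
    u x = Rc (telHolZ L hL U₀ k x)⁻¹
      ((wrecZ L U₀ U₁ k ((flZ L)^[k] x))⁻¹ * telTwZ L hL U₀ U₁ k x) := by
  have h := eq77Z L hL U₀ U₁ u hax k le_rfl x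
  rw [(eq81_iff_eq87Z L U₀ U₁ u hax _).1 (h81 _)] at h
  rw [← h, (Rc_inv_apply _ _).1]

/-- The §4 construction IS print's formula: `glev … k 0 x = R(U₀(Γ^{(k)}_{x_k,x}))⁻¹[(\overline{R_{0,x_k}U₁^{(k)}})⁻¹·(R_{0,x_k}U₁)(Γ^{(k)}_{x_k,x})]`.
[cite: Balaban1985Averaging, (77) p.30, (87) p.31] -/
theorem glevZ_formula (L : ℕ) (hL : 1 ≤ L) (U₀ U₁ : SiteZ d → Fin d → 𝔸ˣ) (k : ℕ) (x : SiteZ d) :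
    glevZ L hL U₀ U₁ k 0 x = Rc (telHolZ L hL U₀ k x)⁻¹
      ((wrecZ L U₀ U₁ k ((flZ L)^[k] x))⁻¹ * telTwZ L hL U₀ U₁ k x) :=
  gauge_formulaZ L hL U₀ U₁ (axialGaugeZ_glevZ L hL U₀ U₁ k) (eq81_glevZ L hL U₀ U₁ k) x

end Telescoped

end Literature.MathematicalPhysics.QuantumFieldTheory.Balaban1983to89.B7Eq84ConcreteRec
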